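import Mathlib
import HarnessLib
import Summits.HubbardSuperconductivity.HubbardSuperconductivity.Theorems.KLProgrammeKLRegimeSectorMultiplierOverlapWt
import Summits.HubbardSuperconductivity.HubbardSuperconductivity.Theorems.KLProgrammeKLRegimeSectorOverlapDefectRows
import Summits.HubbardSuperconductivity.HubbardSuperconductivity.Theorems.KLProgrammeH10TwoPointLimitSectorMultiplierFat
import Summits.HubbardSuperconductivity.HubbardSuperconductivity.Theorems.KLProgrammeKLRegimeTwoVolumeTowerDefs

/-!
# K3 VL child `KLRegimeVolumeLimitV17F2` (stmt-HubbardSuperconductivity-20440), located item #23 «W2-HALF-VL», brick «W2H-OVL» part 6 (ROWS):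
# the `klScaleWt (k+1)`-weighted ROWS and COLUMNS of the re-analysis increment `klReanalysis[K′] k − klReanalysis[K] k` from a uniform weighted
# `ℓ¹` bound on the thin-pair FRAME-DIFFERENCE character sums — the literal (R-row/col) piece shape of `transferWtData_klTowerTransfer_flow_of_pieces`

Cell `gate-hubbard-kl`, seat p3 (g14), lead of #23; the frame-difference twin of p3 g10's `…SectorMultiplierOverlapWt` (one frame).  The increment of the
re-analysis block `klReanalysis V M β μ K k = ε•E(klAniso[K](k+1))·S(F̃[K]_k)` between two frames is, block by block, the kernel of the DIFFERENCE of the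
thin × fat product symbols, i.e. (`klAnisoFamily_mul_bgmFatMultiplier_eq_sum` at each frame) a sum of `≤ 3` thin-pair frame differences
`D_{ω′a} = F^{K′}_{ω′}F^{K′}_a − F^{K}_{ω′}F^{K}_a`; the weighted `ℓ¹` sizes of their character sums are `charSumWt_thinPairDiff_le_of_pointwise`
(`…ThinPairDiffWt`).  Here, for ANY two frames `K, K′` on one lattice `V`:

The block layer (difference block = `(βV²)⁻¹ ×` weighted `ℓ¹` of `S^Δ`: `rowSumWt_overlapKernel_sub_le` / `colSumWt_overlapKernel_sub_le`; the joint
overlap-count reductions `rowSum_wt_overlapKernel_sub_le` / `colSum_wt_overlapKernel_sub_le`, `card_jointOverlap_le(')`) is k3c4-p2's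
`…SectorOverlapDefectRows` (p580907), used by name.  Here, for ANY two frames `K, K′` on one lattice:

* `charSumWt_klAniso_bgmFat_sub_le` — weighted thin × fat DIFFERENCE `≤ 3T` from the weighted thin × thin differences `≤ T` (`≤ 3` neighbours);
* **`rowSumWt_klReanalysis_sub_le`**, **`colSumWt_klReanalysis_sub_le`** — if `Σ_z w_{k+1}(z)‖S[D_{ω′a}](z)‖ ≤ T` for every `ω′` (scale `k+1`) and
  `a` (scale `k`), then every weighted row of the increment is `≤ ε·((27+27)·(3T/(βV²)))` and every weighted column `≤ ε·((54+54)·(3T/(βV²)))`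
  (`ε = imagTimeWeight β M`; joint counts from `card_overlap_klAniso_bgmFat_coarse/fine_le` at each frame).

Everything is proved; no definitions, no sorry.  Nothing asserts any stub, K3, VL or superconductivity. [cite: BenfattoGiulianiMastropietro2006, §2.7 (2.66), (2.71)–(2.71a), §3 (3.3)]
-/

noncomputable section

namespace Summit.HubbardSuperconductivity.HubbardSuperconductivity.Theorems.TorusFourierL2

set_option linter.dupNamespace false -- summit = problem name (single-conjunct summit), D-0017

open Finset Complex Literature.MathematicalPhysics.QuantumLattice Literature.Probability.LatticeModels
open Summit.HubbardSuperconductivity.HubbardSuperconductivity.Theorems.KLProgrammeLegKernels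
open Summit.HubbardSuperconductivity.HubbardSuperconductivity.Theorems.KLRegimeSplit
open Summit.HubbardSuperconductivity.HubbardSuperconductivity.Theorems.EngineV8
open Summit.HubbardSuperconductivity.HubbardSuperconductivity.Theorems.PerturbedFermiCurve
open Summit.HubbardSuperconductivity.HubbardSuperconductivity.Theorems.TwoVolumeSource
open scoped Real ComplexConjugate

open Classical

variable {L M : ℕ} [NeZero L] [NeZero M] {N N' : ℕ}

/-! ### The re-analysis increment: weighted rows and columns from the thin-pair frame differences -/

/-- **Weighted thin × fat DIFFERENCE from weighted thin × thin differences**: if for every neighbour `a ∈ S_{ω₂}` the weighted `ℓ¹` character sum of the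
thin-pair frame difference `F^{K′}_{ω₁}F^{K′}_a − F^{K}_{ω₁}F^{K}_a` is `≤ T` (any nonnegative moment weight), then that of the thin × fat difference
`F^{K′}_{ω₁}F̃^{K′}_{ω₂} − F^{K}_{ω₁}F̃^{K}_{ω₂}` is `≤ 3T` (`n₂ + 1 ≤ n₁`). [cite: BenfattoGiulianiMastropietro2006, §2.7 (2.66), (2.71a)] -/
theorem charSumWt_klAniso_bgmFat_sub_le {e₀ : ℝ} (he : 0 < e₀) (β μ : ℝ) (K K' : TrigPolyC4v) {a b : ℝ} (ha : 0 ≤ a) (hb : 0 ≤ b)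
    {n₁ n₂ : ℕ} (hn : n₂ + 1 ≤ n₁) (ω₁ : Fin (sectorCount n₁)) (ω₂ : Fin (sectorCount n₂)) {T : ℝ} (hT0 : 0 ≤ T)
    (hT : ∀ a' : Fin (sectorCount n₂), ∑ z : TorusSite 1 (2 * M) × TorusSite 2 L,
      (1 + a * |(((z.1 0).valMinAbs : ℤ) : ℝ)| + b * |(((z.2 0).valMinAbs : ℤ) : ℝ)| + b * |(((z.2 1).valMinAbs : ℤ) : ℝ)|) *
      ‖∑ q : TorusSite 1 (2 * M) × TorusSite 2 L, (torusChar q.1 z.1 * torusChar q.2 z.2) •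
        (klAnisoFamily L M β μ K' e₀ n₁ ω₁ (⟨(q.1 0).val, ZMod.val_lt (q.1 0)⟩, q.2) *
            klAnisoFamily L M β μ K' e₀ n₂ a' (⟨(q.1 0).val, ZMod.val_lt (q.1 0)⟩, q.2) -
          klAnisoFamily L M β μ K e₀ n₁ ω₁ (⟨(q.1 0).val, ZMod.val_lt (q.1 0)⟩, q.2) *
            klAnisoFamily L M β μ K e₀ n₂ a' (⟨(q.1 0).val, ZMod.val_lt (q.1 0)⟩, q.2))‖ ≤ T) :
    ∑ z : TorusSite 1 (2 * M) × TorusSite 2 L,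
      (1 + a * |(((z.1 0).valMinAbs : ℤ) : ℝ)| + b * |(((z.2 0).valMinAbs : ℤ) : ℝ)| + b * |(((z.2 1).valMinAbs : ℤ) : ℝ)|) *
      ‖∑ q : TorusSite 1 (2 * M) × TorusSite 2 L, (torusChar q.1 z.1 * torusChar q.2 z.2) •
        (klAnisoFamily L M β μ K' e₀ n₁ ω₁ (⟨(q.1 0).val, ZMod.val_lt (q.1 0)⟩, q.2) *
            bgmFatMultiplier L M e₀ β (nambuXiCT L μ K') n₂ ω₂ (⟨(q.1 0).val, ZMod.val_lt (q.1 0)⟩, q.2) -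
          klAnisoFamily L M β μ K e₀ n₁ ω₁ (⟨(q.1 0).val, ZMod.val_lt (q.1 0)⟩, q.2) *
            bgmFatMultiplier L M e₀ β (nambuXiCT L μ K) n₂ ω₂ (⟨(q.1 0).val, ZMod.val_lt (q.1 0)⟩, q.2))‖ ≤ 3 * T := by
  set S := (univ : Finset (Fin (sectorCount n₂))).filter (fun a' : Fin (sectorCount n₂) =>
      ∃ δ : ℤ, |δ| ≤ 1 ∧ (sectorCount n₂ : ℤ) ∣ (((a' : ℕ) : ℤ) - ((ω₂ : ℕ) : ℤ) - δ)) with hS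
  have hScard : S.card ≤ 3 := card_fatNbrFin_le_three n₂ (ω₂ : ℕ)
  have hw0 : ∀ z : TorusSite 1 (2 * M) × TorusSite 2 L,
      0 ≤ 1 + a * |(((z.1 0).valMinAbs : ℤ) : ℝ)| + b * |(((z.2 0).valMinAbs : ℤ) : ℝ)| + b * |(((z.2 1).valMinAbs : ℤ) : ℝ)| :=
    fun z => by positivity
  have hsub : ∀ q : TorusSite 1 (2 * M) × TorusSite 2 L,
      klAnisoFamily L M β μ K' e₀ n₁ ω₁ (⟨(q.1 0).val, ZMod.val_lt (q.1 0)⟩, q.2) *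
            bgmFatMultiplier L M e₀ β (nambuXiCT L μ K') n₂ ω₂ (⟨(q.1 0).val, ZMod.val_lt (q.1 0)⟩, q.2) -
          klAnisoFamily L M β μ K e₀ n₁ ω₁ (⟨(q.1 0).val, ZMod.val_lt (q.1 0)⟩, q.2) *
            bgmFatMultiplier L M e₀ β (nambuXiCT L μ K) n₂ ω₂ (⟨(q.1 0).val, ZMod.val_lt (q.1 0)⟩, q.2) =
        ∑ a' ∈ S, (klAnisoFamily L M β μ K' e₀ n₁ ω₁ (⟨(q.1 0).val, ZMod.val_lt (q.1 0)⟩, q.2) *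
            klAnisoFamily L M β μ K' e₀ n₂ a' (⟨(q.1 0).val, ZMod.val_lt (q.1 0)⟩, q.2) -
          klAnisoFamily L M β μ K e₀ n₁ ω₁ (⟨(q.1 0).val, ZMod.val_lt (q.1 0)⟩, q.2) *
            klAnisoFamily L M β μ K e₀ n₂ a' (⟨(q.1 0).val, ZMod.val_lt (q.1 0)⟩, q.2)) := by
    intro q
    rw [klAnisoFamily_mul_bgmFatMultiplier_eq_sum he β μ K' hn ω₁ ω₂, klAnisoFamily_mul_bgmFatMultiplier_eq_sum he β μ K hn ω₁ ω₂,
      ← Finset.sum_sub_distrib]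
  simp_rw [hsub]
  refine (sum_wt_norm_charSum_sum_le S _ hw0 (fun a' q =>
    klAnisoFamily L M β μ K' e₀ n₁ ω₁ (⟨(q.1 0).val, ZMod.val_lt (q.1 0)⟩, q.2) * klAnisoFamily L M β μ K' e₀ n₂ a' (⟨(q.1 0).val, ZMod.val_lt (q.1 0)⟩, q.2) -
      klAnisoFamily L M β μ K e₀ n₁ ω₁ (⟨(q.1 0).val, ZMod.val_lt (q.1 0)⟩, q.2) *
        klAnisoFamily L M β μ K e₀ n₂ a' (⟨(q.1 0).val, ZMod.val_lt (q.1 0)⟩, q.2))).trans ?_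
  calc _ ≤ ∑ _a ∈ S, T := Finset.sum_le_sum fun a' _ => hT a'
    _ = S.card * T := by rw [Finset.sum_const, nsmul_eq_mul]
    _ ≤ 3 * T := mul_le_mul_of_nonneg_right (by exact_mod_cast hScard) hT0

/-- **Weighted ROWS of the re-analysis increment from a uniform weighted bound on the thin-pair frame differences** (weight scale `k+1`):
`Σ_{X′} ‖(klReanalysis[K′] k − klReanalysis[K] k) X″ X′‖·wt_{k+1}{pos X″, pos X′} ≤ ε·((27+27)·(3T/(βL²)))` — the (R-row) piece shape of
`transferWtData_klTowerTransfer_flow_of_pieces`. [cite: BenfattoGiulianiMastropietro2006, §2.7 (2.71)–(2.71a), §3 (3.3)] -/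
theorem rowSumWt_klReanalysis_sub_le {β : ℝ} (hβ : 0 < β) (μ : ℝ) (K K' : TrigPolyC4v) (k : ℕ) {T : ℝ} (hT0 : 0 ≤ T)
    (hT : ∀ (ω₁ : Fin (sectorCount (k + 1))) (a' : Fin (sectorCount k)), ∑ z : TorusSite 1 (2 * M) × TorusSite 2 L,
      (1 + klScale klE0 (k + 1) * β / (2 * M) * |(((z.1 0).valMinAbs : ℤ) : ℝ)| + klScale klE0 (k + 1) * |(((z.2 0).valMinAbs : ℤ) : ℝ)| +
          klScale klE0 (k + 1) * |(((z.2 1).valMinAbs : ℤ) : ℝ)|) *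
      ‖∑ q : TorusSite 1 (2 * M) × TorusSite 2 L, (torusChar q.1 z.1 * torusChar q.2 z.2) •
        (klAnisoFamily L M β μ K' klE0 (k + 1) ω₁ (⟨(q.1 0).val, ZMod.val_lt (q.1 0)⟩, q.2) *
            klAnisoFamily L M β μ K' klE0 k a' (⟨(q.1 0).val, ZMod.val_lt (q.1 0)⟩, q.2) -
          klAnisoFamily L M β μ K klE0 (k + 1) ω₁ (⟨(q.1 0).val, ZMod.val_lt (q.1 0)⟩, q.2) *
            klAnisoFamily L M β μ K klE0 k a' (⟨(q.1 0).val, ZMod.val_lt (q.1 0)⟩, q.2))‖ ≤ T)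
    (X'' : SpaceTimeIdx L M × SectorLeg (sectorCount (k + 1))) :
    ∑ X' : SpaceTimeIdx L M × SectorLeg (sectorCount k), ‖(klReanalysis L M β μ K' k - klReanalysis L M β μ K k) X'' X'‖ *
        klScaleWt L M β (k + 1) {latticeLegPos (2 * (2 * M)) X'', latticeLegPos (2 * (2 * M)) X'} ≤
      imagTimeWeight β M * (((27 : ℕ) + (27 : ℕ)) * (3 * T / (β * (L : ℝ) ^ 2))) := by
  have he : (0 : ℝ) < klE0 := by norm_num [klE0]
  have hΛ : 0 ≤ klScale klE0 (k + 1) := (klth_klScale_pos (k + 1)).le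
  have hM : (0 : ℝ) < M := Nat.cast_pos.2 (Nat.pos_of_ne_zero (NeZero.ne M))
  have hL : (0 : ℝ) < L := Nat.cast_pos.2 (Nat.pos_of_ne_zero (NeZero.ne L))
  have hε : 0 ≤ imagTimeWeight β M := imagTimeWeight_nonneg hβ.le M
  have hk : k + 1 ≤ k + 1 := le_rfl
  -- the increment matrix is `ε •` the difference of the two product kernels
  set A : Matrix (SpaceTimeIdx L M × SectorLeg (sectorCount (k + 1))) (SpaceTimeIdx L M × SectorLeg (sectorCount k)) ℂ :=
    sectorAnalysisMatrix L M β (klAnisoFamily L M β μ K' klE0 (k + 1)) * sectorSubMatrix L M β (bgmFatMultiplier L M klE0 β (nambuXiCT L μ K') k) -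
      sectorAnalysisMatrix L M β (klAnisoFamily L M β μ K klE0 (k + 1)) * sectorSubMatrix L M β (bgmFatMultiplier L M klE0 β (nambuXiCT L μ K) k)
    with hAdef
  have hentry : ∀ X', ‖(klReanalysis L M β μ K' k - klReanalysis L M β μ K k) X'' X'‖ = imagTimeWeight β M * ‖A X'' X'‖ := by
    intro X'
    rw [Matrix.sub_apply, klReanalysis_eq_smul, klReanalysis_eq_smul, Matrix.smul_apply, Matrix.smul_apply, smul_eq_mul, smul_eq_mul, ← mul_sub,
      norm_mul, Complex.norm_real, Real.norm_eq_abs, abs_of_nonneg hε, hAdef, Matrix.sub_apply]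
  simp_rw [hentry, mul_assoc, ← Finset.mul_sum]
  refine mul_le_mul_of_nonneg_left ?_ hε
  -- one difference block
  have hblock : ∀ (ω' : Fin (sectorCount (k + 1))) (ω : Fin (sectorCount k)) (σ c : Fin 2) (y : SpaceTimeIdx L M),
      ∑ x : SpaceTimeIdx L M, ‖A (y, ((ω', σ), c)) (x, ((ω, σ), c))‖ *
        klScaleWt L M β (k + 1) {latticeLegPos (2 * (2 * M)) ((y, ((ω', σ), c)) : SpaceTimeIdx L M × SectorLeg (sectorCount (k + 1))),
          latticeLegPos (2 * (2 * M)) ((x, ((ω, σ), c)) : SpaceTimeIdx L M × SectorLeg (sectorCount k))} ≤ 3 * T / (β * (L : ℝ) ^ 2) := by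
    intro ω' ω σ c y
    refine (rowSumWt_overlapKernel_sub_le hβ _ _ _ _ (k + 1) ω' ω σ c y).trans ?_
    rw [div_eq_mul_one_div (3 * T) (β * (L : ℝ) ^ 2), mul_comm (3 * T)]
    exact mul_le_mul_of_nonneg_left (charSumWt_klAniso_bgmFat_sub_le he β μ K K' (by positivity) hΛ hk ω' ω hT0 (hT ω')) (by positivity)
  have h := rowSum_wt_overlapKernel_sub_le β _ _ _ _
    (fun ω₁ => card_jointOverlap_le _ _ _ _ ω₁ (card_overlap_klAniso_bgmFat_coarse_le he β μ K' (Nat.le_succ k) ω₁)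
      (card_overlap_klAniso_bgmFat_coarse_le he β μ K (Nat.le_succ k) ω₁))
    (fun Y' Y => klScaleWt L M β (k + 1) {latticeLegPos (2 * (2 * M)) Y', latticeLegPos (2 * (2 * M)) Y}) (by positivity) hblock X''
  simpa only [hAdef, Nat.cast_add] using h

/-- **Weighted COLUMNS of the re-analysis increment from a uniform weighted bound on the thin-pair frame differences** (weight scale `k+1`):
`Σ_{X″} ‖(klReanalysis[K′] k − klReanalysis[K] k) X″ X′‖·wt_{k+1}{pos X″, pos X′} ≤ ε·((54+54)·(3T/(βL²)))` — the (R-col) piece shape.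
[cite: BenfattoGiulianiMastropietro2006, §2.7 (2.71)–(2.71a), §3 (3.3)] -/
theorem colSumWt_klReanalysis_sub_le {β : ℝ} (hβ : 0 < β) (μ : ℝ) (K K' : TrigPolyC4v) (k : ℕ) {T : ℝ} (hT0 : 0 ≤ T)
    (hT : ∀ (ω₁ : Fin (sectorCount (k + 1))) (a' : Fin (sectorCount k)), ∑ z : TorusSite 1 (2 * M) × TorusSite 2 L,
      (1 + klScale klE0 (k + 1) * β / (2 * M) * |(((z.1 0).valMinAbs : ℤ) : ℝ)| + klScale klE0 (k + 1) * |(((z.2 0).valMinAbs : ℤ) : ℝ)| +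
          klScale klE0 (k + 1) * |(((z.2 1).valMinAbs : ℤ) : ℝ)|) *
      ‖∑ q : TorusSite 1 (2 * M) × TorusSite 2 L, (torusChar q.1 z.1 * torusChar q.2 z.2) •
        (klAnisoFamily L M β μ K' klE0 (k + 1) ω₁ (⟨(q.1 0).val, ZMod.val_lt (q.1 0)⟩, q.2) *
            klAnisoFamily L M β μ K' klE0 k a' (⟨(q.1 0).val, ZMod.val_lt (q.1 0)⟩, q.2) -
          klAnisoFamily L M β μ K klE0 (k + 1) ω₁ (⟨(q.1 0).val, ZMod.val_lt (q.1 0)⟩, q.2) *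
            klAnisoFamily L M β μ K klE0 k a' (⟨(q.1 0).val, ZMod.val_lt (q.1 0)⟩, q.2))‖ ≤ T)
    (X' : SpaceTimeIdx L M × SectorLeg (sectorCount k)) :
    ∑ X'' : SpaceTimeIdx L M × SectorLeg (sectorCount (k + 1)), ‖(klReanalysis L M β μ K' k - klReanalysis L M β μ K k) X'' X'‖ *
        klScaleWt L M β (k + 1) {latticeLegPos (2 * (2 * M)) X'', latticeLegPos (2 * (2 * M)) X'} ≤
      imagTimeWeight β M * (((27 * 2 ^ (k + 1 - k) : ℕ) + (27 * 2 ^ (k + 1 - k) : ℕ)) * (3 * T / (β * (L : ℝ) ^ 2))) := by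
  have he : (0 : ℝ) < klE0 := by norm_num [klE0]
  have hΛ : 0 ≤ klScale klE0 (k + 1) := (klth_klScale_pos (k + 1)).le
  have hM : (0 : ℝ) < M := Nat.cast_pos.2 (Nat.pos_of_ne_zero (NeZero.ne M))
  have hL : (0 : ℝ) < L := Nat.cast_pos.2 (Nat.pos_of_ne_zero (NeZero.ne L))
  have hε : 0 ≤ imagTimeWeight β M := imagTimeWeight_nonneg hβ.le M
  have hk : k + 1 ≤ k + 1 := le_rfl
  set A : Matrix (SpaceTimeIdx L M × SectorLeg (sectorCount (k + 1))) (SpaceTimeIdx L M × SectorLeg (sectorCount k)) ℂ :=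
    sectorAnalysisMatrix L M β (klAnisoFamily L M β μ K' klE0 (k + 1)) * sectorSubMatrix L M β (bgmFatMultiplier L M klE0 β (nambuXiCT L μ K') k) -
      sectorAnalysisMatrix L M β (klAnisoFamily L M β μ K klE0 (k + 1)) * sectorSubMatrix L M β (bgmFatMultiplier L M klE0 β (nambuXiCT L μ K) k)
    with hAdef
  have hentry : ∀ X'', ‖(klReanalysis L M β μ K' k - klReanalysis L M β μ K k) X'' X'‖ = imagTimeWeight β M * ‖A X'' X'‖ := by
    intro X''
    rw [Matrix.sub_apply, klReanalysis_eq_smul, klReanalysis_eq_smul, Matrix.smul_apply, Matrix.smul_apply, smul_eq_mul, smul_eq_mul, ← mul_sub,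
      norm_mul, Complex.norm_real, Real.norm_eq_abs, abs_of_nonneg hε, hAdef, Matrix.sub_apply]
  simp_rw [hentry, mul_assoc, ← Finset.mul_sum]
  refine mul_le_mul_of_nonneg_left ?_ hε
  have hblock : ∀ (ω' : Fin (sectorCount (k + 1))) (ω : Fin (sectorCount k)) (σ c : Fin 2) (x : SpaceTimeIdx L M),
      ∑ y : SpaceTimeIdx L M, ‖A (y, ((ω', σ), c)) (x, ((ω, σ), c))‖ *
        klScaleWt L M β (k + 1) {latticeLegPos (2 * (2 * M)) ((y, ((ω', σ), c)) : SpaceTimeIdx L M × SectorLeg (sectorCount (k + 1))),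
          latticeLegPos (2 * (2 * M)) ((x, ((ω, σ), c)) : SpaceTimeIdx L M × SectorLeg (sectorCount k))} ≤ 3 * T / (β * (L : ℝ) ^ 2) := by
    intro ω' ω σ c x
    refine (colSumWt_overlapKernel_sub_le hβ _ _ _ _ (k + 1) ω' ω σ c x).trans ?_
    rw [div_eq_mul_one_div (3 * T) (β * (L : ℝ) ^ 2), mul_comm (3 * T)]
    exact mul_le_mul_of_nonneg_left (charSumWt_klAniso_bgmFat_sub_le he β μ K K' (by positivity) hΛ hk ω' ω hT0 (hT ω')) (by positivity)
  have h := colSum_wt_overlapKernel_sub_le β _ _ _ _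
    (fun ω₂ => card_jointOverlap_le' _ _ _ _ ω₂ (card_overlap_klAniso_bgmFat_fine_le he β μ K' (Nat.le_succ k) ω₂)
      (card_overlap_klAniso_bgmFat_fine_le he β μ K (Nat.le_succ k) ω₂))
    (fun Y' Y => klScaleWt L M β (k + 1) {latticeLegPos (2 * (2 * M)) Y', latticeLegPos (2 * (2 * M)) Y}) (by positivity) hblock X'
  simpa only [hAdef, Nat.cast_add] using h

end Summit.HubbardSuperconductivity.HubbardSuperconductivity.Theorems.TorusFourierL2

end
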